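import Literature.AlgebraicGeometry.Motives.NonsingularFormIrreducible
import Literature.AlgebraicGeometry.Motives.SmoothHypersurfaceIrreducible
import Literature.AlgebraicGeometry.Motives.CompleteIntersection
import Literature.AlgebraicGeometry.Motives.ClosedSubvarietyOfPoint
import HarnessLib

/-!
# The Jacobian condition for a pair `(Q, C)`: `Q` is prime and `Q ∤ C`; `V₊(Q)` is integral

Two elementary consequences of the projective Jacobian criterion `IsNonsingularSystem K ![Q, C]`
(`Motives/CompleteIntersection`: every prime containing `Q`, `C` and all `2 × 2` minors
`∂ᵢQ ∂ⱼC - ∂ⱼQ ∂ᵢC` of the Jacobian matrix contains every variable) for forms `Q` of degree `2` and `C`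
of degree `d ≥ 1` in at least four variables, needed to apply Fulton's Gysin map to the pair
`V₊(Q, C) ⊂ V₊(Q)` (Hirschowitz–Iyer 2010, §2, on `ℙ⁸`):

* `IsNonsingularSystem.irreducible_fst`, `IsNonsingularSystem.prime_fst` — **`Q` is irreducible,
  hence prime**: a factorisation `Q = G'H'` into forms of positive degree makes every Jacobian minor
  lie in `(G', H')`, and `V(G', H', C) ⊆ 𝔸ⁿ⁺²` has a non-zero point (Krull's height theorem: a
  minimal prime of `(G', H', C)` inside the maximal ideal of the origin has height `≤ 3 < n + 2`) —
  the argument of `Motives/NonsingularFormIrreducible` (Hartshorne II Example 8.20.2) with one more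
  equation;
* `IsNonsingularSystem.not_dvd_snd` — **`Q ∤ C`**: if `C = Q L` every minor is a multiple of `Q`;
* `isIntegral_completeIntersection_of_prime` — `V₊(F)` with its reduced structure
  (`completeIntersection (fun _ => F)`) is integral for a prime form `F` (it is the reduced closed
  subscheme on the irreducible closed set `V₊(F) = closure {(F)}`);
* `completeIntersectionι_genericPoint_eq_pointOfPrime` — its generic point maps to the point `(F)` of
  `ℙⁿ⁺¹`, so that **a form `G` vanishes on `V₊(F)` iff `F ∣ G`**
  (`mem_asHomogeneousIdeal_genericPoint_iff_dvd`).

Everything is proved; no named facts.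

## References

* R. Hartshorne, *Algebraic Geometry*, GTM 52 (1977): I Ex. 5.8, I Thm. 7.2, II Example 8.20.2,
  II Ex. 2.9. [Hartshorne1977]
* A. Hirschowitz, J. N. Iyer, Contemp. Math. 522 (2010), §2. [HirschowitzIyer2010]
-/

noncomputable section

open MvPolynomial

universe u

namespace Literature.AlgebraicGeometry.Motives

open SmoothHypersurface CompleteIntersection

/-! ### Primes containing few forms miss a variable -/

section Algebra

variable {K : Type u} [Field K] {n : ℕ}

/-- **`V(P₁, …, P_c) ⊆ 𝔸ⁿ⁺²` has a non-zero point when `c < n + 2`** (forms of positive degree):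
there is a prime ideal containing the `P_a` but not all the variables — a minimal prime of
`(P₁, …, P_c)` inside the maximal ideal of the origin has height `≤ c` (Krull's height theorem,
Mathlib `Ideal.height_le_card_of_mem_minimalPrimes_span_finset`) while that maximal ideal has height
`n + 2`. [cite: Hartshorne1977, I Thm. 7.2] -/
theorem exists_isPrime_forall_mem_X_notMem {s : Finset (MvPolynomial (Fin (n + 2)) K)}
    (hs : ∀ P ∈ s, ∃ e, 1 ≤ e ∧ P.IsHomogeneous e) (hcard : s.card < n + 2) :
    ∃ 𝔭 : Ideal (MvPolynomial (Fin (n + 2)) K), 𝔭.IsPrime ∧ (∀ P ∈ s, P ∈ 𝔭) ∧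
      ∃ i, (X i : MvPolynomial (Fin (n + 2)) K) ∉ 𝔭 := by
  classical
  -- the maximal ideal of the origin
  let J : Ideal (MvPolynomial (Fin (n + 2)) K) := MvPolynomial.vanishingIdeal K {(0 : Fin (n + 2) → K)}
  have hJmem : ∀ {e : ℕ} {P : MvPolynomial (Fin (n + 2)) K}, 1 ≤ e → P.IsHomogeneous e → P ∈ J :=
    fun he hP => by
      rw [MvPolynomial.mem_vanishingIdeal_singleton_iff, aeval_zero_eq_coeff_zero,
        coeff_zero_of_isHomogeneous he hP]
  let I : Ideal (MvPolynomial (Fin (n + 2)) K) := Ideal.span (s : Set _)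
  have hIJ : I ≤ J := by
    refine Ideal.span_le.mpr fun P hP => ?_
    obtain ⟨e, he, hP⟩ := hs P hP
    exact hJmem he hP
  obtain ⟨𝔭, h𝔭min, h𝔭J⟩ := Ideal.exists_minimalPrimes_le hIJ
  have h𝔭prime : 𝔭.IsPrime := h𝔭min.1.1
  have hI𝔭 : I ≤ 𝔭 := h𝔭min.1.2
  refine ⟨𝔭, h𝔭prime, fun P hP => hI𝔭 (Ideal.subset_span hP), ?_⟩
  by_contra! hall
  have hJ𝔭 : J ≤ 𝔭 := fun P hP => by
    have hP0 : coeff 0 P = 0 := by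
      have := (MvPolynomial.mem_vanishingIdeal_singleton_iff _ _).mp hP
      rwa [aeval_zero_eq_coeff_zero] at this
    exact Ideal.span_le.mpr (Set.range_subset_iff.mpr hall) (mem_span_X_of_coeff_zero hP0)
  have heq : 𝔭 = J := le_antisymm h𝔭J hJ𝔭
  have hht : 𝔭.height ≤ s.card := Ideal.height_le_card_of_mem_minimalPrimes_span_finset h𝔭min
  rw [heq, MvPolynomial.height_eq_of_isMaximal K (n + 2) J] at hht
  norm_cast at hht
  omega

/-! ### The Jacobian condition for a pair -/

/-- The Jacobian minors of a pair `(Q, C)`: `∂_{r0} Q · ∂_{r1} C - ∂_{r1} Q · ∂_{r0} C`. [folklore] -/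
theorem jacobianMinor_pair (Q C : MvPolynomial (Fin (n + 2)) K) (r : Fin 2 → Fin (n + 2)) :
    jacobianMinor ![Q, C] r = pderiv (r 0) Q * pderiv (r 1) C - pderiv (r 1) Q * pderiv (r 0) C := by
  rw [jacobianMinor_def, Matrix.det_fin_two]
  simp only [Matrix.of_apply, Matrix.cons_val_zero, Matrix.cons_val_one]

/-- From the Jacobian condition for `(Q, C)`: a prime containing `Q`, `C` and all the partial
derivatives of `Q` contains every variable. [folklore] -/
theorem IsNonsingularSystem.forall_X_mem_of_pderiv_mem {Q C : MvPolynomial (Fin (n + 2)) K}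
    (hJ : IsNonsingularSystem K ![Q, C]) {𝔭 : Ideal (MvPolynomial (Fin (n + 2)) K)} (h𝔭 : 𝔭.IsPrime)
    (hQ : Q ∈ 𝔭) (hC : C ∈ 𝔭) (hder : ∀ j, pderiv j Q ∈ 𝔭) (i : Fin (n + 2)) :
    (X i : MvPolynomial (Fin (n + 2)) K) ∈ 𝔭 := by
  refine hJ 𝔭 h𝔭 (fun a => ?_) (fun r => ?_) i
  · fin_cases a
    · exact hQ
    · exact hC
  · rw [jacobianMinor_pair]
    exact 𝔭.sub_mem (𝔭.mul_mem_right _ (hder _)) (𝔭.mul_mem_right _ (hder _))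

/-- **`Q` is irreducible** if `(Q, C)` satisfies the Jacobian condition, `Q` of degree `2`, `C` of
degree `d ≥ 1`, in `n + 2 ≥ 4` variables: a factorisation `Q = G'H'` into forms of positive degree
puts all `∂ⱼQ` in `(G', H')`, and a prime over `(G', H', C)` missing a variable exists
(`exists_isPrime_forall_mem_X_notMem`). [cite: Hartshorne1977, II Example 8.20.2] -/
theorem IsNonsingularSystem.irreducible_fst (hn : 2 ≤ n) {Q C : MvPolynomial (Fin (n + 2)) K}
    (hQ : Q.IsHomogeneous 2) {d : ℕ} (hd : 1 ≤ d) (hC : C.IsHomogeneous d)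
    (hJ : IsNonsingularSystem K ![Q, C]) : Irreducible Q := by
  classical
  -- `Q ≠ 0`
  have hQ0 : Q ≠ 0 := by
    rintro rfl
    obtain ⟨𝔭, h𝔭, hmem, i, hi⟩ := exists_isPrime_forall_mem_X_notMem (s := {C})
      (fun P hP => ⟨d, hd, by rw [Finset.mem_singleton.mp hP]; exact hC⟩) (by simp)
    exact hi (hJ.forall_X_mem_of_pderiv_mem h𝔭 𝔭.zero_mem (hmem C (Finset.mem_singleton_self C))
      (fun j => by rw [map_zero]; exact 𝔭.zero_mem) i)
  refine irreducible_iff.mpr ⟨fun hu => ?_, fun G H hGH => ?_⟩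
  · have h0 := ((isUnit_iff_totalDegree_of_isReduced).mp hu).2
    rw [hQ.totalDegree hQ0] at h0
    omega
  by_contra hGH'
  push Not at hGH'
  obtain ⟨a, b, G', H', ha, hb, hG', hH', hfac⟩ := exists_isHomogeneous_mul_eq hQ hQ0 hGH hGH'.1 hGH'.2
  obtain ⟨𝔭, h𝔭, hmem, i, hi⟩ := exists_isPrime_forall_mem_X_notMem (s := {G', H', C})
    (fun P hP => by
      simp only [Finset.mem_insert, Finset.mem_singleton] at hP
      rcases hP with rfl | rfl | rfl
      · exact ⟨a, ha, hG'⟩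
      · exact ⟨b, hb, hH'⟩
      · exact ⟨d, hd, hC⟩)
    (lt_of_le_of_lt (Finset.card_le_three) (by omega))
  have hG'𝔭 : G' ∈ 𝔭 := hmem G' (by simp)
  have hH'𝔭 : H' ∈ 𝔭 := hmem H' (by simp)
  refine hi (hJ.forall_X_mem_of_pderiv_mem h𝔭 ?_ (hmem C (by simp)) (fun j => ?_) i)
  · rw [hfac]
    exact 𝔭.mul_mem_right _ hG'𝔭
  · rw [hfac, pderiv_mul]
    exact 𝔭.add_mem (𝔭.mul_mem_left _ hH'𝔭) (𝔭.mul_mem_right _ hG'𝔭)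

/-- Hence `Q` is prime (`K[x]` is factorial). [folklore] -/
theorem IsNonsingularSystem.prime_fst (hn : 2 ≤ n) {Q C : MvPolynomial (Fin (n + 2)) K}
    (hQ : Q.IsHomogeneous 2) {d : ℕ} (hd : 1 ≤ d) (hC : C.IsHomogeneous d)
    (hJ : IsNonsingularSystem K ![Q, C]) : Prime Q :=
  (hJ.irreducible_fst hn hQ hd hC).prime

/-- **`Q ∤ C`** if `(Q, C)` satisfies the Jacobian condition (`Q` a form of positive degree): for
`C = Q L` the minors `∂ᵢQ ∂ⱼC - ∂ⱼQ ∂ᵢC = Q (∂ᵢQ ∂ⱼL - ∂ⱼQ ∂ᵢL)` lie in every prime over `Q`, and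
such a prime missing a variable exists. [cite: Hartshorne1977, I Ex. 5.8] -/
theorem IsNonsingularSystem.not_dvd_snd {Q C : MvPolynomial (Fin (n + 2)) K} {e : ℕ} (he : 1 ≤ e)
    (hQ : Q.IsHomogeneous e) (hJ : IsNonsingularSystem K ![Q, C]) : ¬ Q ∣ C := by
  classical
  rintro ⟨L, rfl⟩
  obtain ⟨𝔭, h𝔭, hmem, i, hi⟩ := exists_isPrime_forall_mem_X_notMem (s := {Q})
    (fun P hP => ⟨e, he, by rw [Finset.mem_singleton.mp hP]; exact hQ⟩) (by simp)
  have hQ𝔭 : Q ∈ 𝔭 := hmem Q (Finset.mem_singleton_self Q)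
  refine hi (hJ 𝔭 h𝔭 (fun a => ?_) (fun r => ?_) i)
  · fin_cases a
    · exact hQ𝔭
    · exact 𝔭.mul_mem_right _ hQ𝔭
  · rw [jacobianMinor_pair]
    have e1 : pderiv (r 0) Q * pderiv (r 1) (Q * L) - pderiv (r 1) Q * pderiv (r 0) (Q * L) =
        Q * (pderiv (r 0) Q * pderiv (r 1) L - pderiv (r 1) Q * pderiv (r 0) L) := by
      rw [pderiv_mul, pderiv_mul]; ring
    rw [e1]
    exact 𝔭.mul_mem_right _ hQ𝔭

end Algebra

/-! ### `V₊(F)` is integral for a prime form; its generic point is `(F)` -/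

section Scheme

variable {K : Type u} [Field K] {n : ℕ}

attribute [local instance] MvPolynomial.gradedAlgebra

open CategoryTheory AlgebraicGeometry TopologicalSpace

/-- `V₊(F) = closure {(F)}` as closed subsets of `ℙⁿ⁺¹`, for a prime form `F`. [folklore] -/
theorem zeroLocusClosed_const_eq_closure {d : ℕ} (F : MvPolynomial (Fin (n + 2)) K)
    (hF : F.IsHomogeneous d) (hp : Prime F) :
    zeroLocusClosed (fun _ : Fin 1 => F) = ⟨closure {pointOfPrime F hF hp}, isClosed_closure⟩ := by
  apply Closeds.ext
  rw [CompleteIntersection.coe_zeroLocusClosed, Set.range_const]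
  exact zeroLocus_eq_closure_pointOfPrime F hF hp

/-- **`V₊(F)` with its reduced structure is integral for a prime form `F`** (it is the reduced
closed subscheme on `closure {(F)}`, `isIntegral_subscheme_vanishingIdeal_closure`).
[cite: Hartshorne1977, II Ex. 2.9] -/
theorem isIntegral_completeIntersection_of_prime {d : ℕ} (F : MvPolynomial (Fin (n + 2)) K)
    (hF : F.IsHomogeneous d) (hp : Prime F) :
    AlgebraicGeometry.IsIntegral (completeIntersection (fun _ : Fin 1 => F)).left := by
  change AlgebraicGeometry.IsIntegral
    (AlgebraicGeometry.Scheme.IdealSheafData.vanishingIdeal (zeroLocusClosed (fun _ : Fin 1 => F))).subscheme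
  rw [zeroLocusClosed_const_eq_closure F hF hp]
  exact isIntegral_subscheme_vanishingIdeal_closure _

/-- The generic point of the integral `V₊(F)` maps to the point `(F)` of `ℙⁿ⁺¹`. [folklore] -/
theorem completeIntersectionι_genericPoint_eq_pointOfPrime {d : ℕ} (F : MvPolynomial (Fin (n + 2)) K)
    (hF : F.IsHomogeneous d) (hp : Prime F) [AlgebraicGeometry.IsIntegral (completeIntersection (fun _ : Fin 1 => F)).left] :
    (completeIntersectionι (fun _ : Fin 1 => F)).left (genericPoint (completeIntersection (fun _ : Fin 1 => F)).left) =
      pointOfPrime F hF hp := by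
  have hrange : Set.range (completeIntersectionι (fun _ : Fin 1 => F)).left = closure {pointOfPrime F hF hp} := by
    rw [range_completeIntersectionι, Set.range_const]
    exact zeroLocus_eq_closure_pointOfPrime F hF hp
  have h1 : IsGenericPoint ((completeIntersectionι (fun _ : Fin 1 => F)).left
      (genericPoint (completeIntersection (fun _ : Fin 1 => F)).left)) (closure {pointOfPrime F hF hp}) := by
    have h := (genericPoint_spec (completeIntersection (fun _ : Fin 1 => F)).left).image
      (completeIntersectionι (fun _ : Fin 1 => F)).left.continuous
    rw [Set.image_univ, hrange] at h
    exact isGenericPoint_def.mpr ((isGenericPoint_def.mp h).trans closure_closure)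
  exact h1.eq isGenericPoint_closure

/-- **A form `G` vanishes on the integral hypersurface `V₊(F)` (lies in the homogeneous prime of its
generic point) iff `F ∣ G`.** [cite: Hartshorne1977, II Ex. 2.9] -/
theorem mem_asHomogeneousIdeal_genericPoint_iff_dvd {d : ℕ} (F : MvPolynomial (Fin (n + 2)) K)
    (hF : F.IsHomogeneous d) (hp : Prime F) [AlgebraicGeometry.IsIntegral (completeIntersection (fun _ : Fin 1 => F)).left]
    (G : MvPolynomial (Fin (n + 2)) K) :
    G ∈ ((completeIntersectionι (fun _ : Fin 1 => F)).left
      (genericPoint (completeIntersection (fun _ : Fin 1 => F)).left)).asHomogeneousIdeal ↔ F ∣ G := by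
  rw [completeIntersectionι_genericPoint_eq_pointOfPrime F hF hp]
  exact Ideal.mem_span_singleton

end Scheme

end Literature.AlgebraicGeometry.Motives

end
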